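import Mathlib
import HarnessLib
import Literature.MathematicalPhysics.QuantumFieldTheory.YangMillsOS
import Literature.MathematicalPhysics.QuantumLattice.LatticeGaugeDLR

/-!
# Sketch — crux-ideate stmt-QuantumFields-10604 (DiagonalMirrorRPR), ideator 1, round 1

First-lemma signatures for the idea cards (they only have to ELABORATE; nothing is proved here):

* `swapEdge`, `diagReflect`, `diagCoord` — the diagonal reflection `x₀ ↔ x₁` on `ℤ⁴`-configurations.
* card `fortyfive-cover-descent`:
  `SkewTorusDiagonalRP` — Wilson's measure on the FILS 45° torus
  `T̃_N = ℤ⁴/⟨N(e₀+e₁), N(e₀−e₁), Ne₂, Ne₃⟩` (realised on `Λ̃`-periodic configurations of `ℤ⁴`) is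
  EXACTLY reflection positive for the swap `x₀ ↔ x₁` (two pointwise-fixed site layers `u = 0, N`);
  `CoverInsensitivity` — the 2:1 cover `T̃_{N_k} → ℤ⁴/N_kℤ⁴` does not change the scaling limit of the
  curvature strings (compactly supported test functions);
* card `seam-twist-identity`: `SymmetricBoxDiagonalRP` — exact diagonal RP of the finite-volume Wilson
  kernel `γ_Λ(·|η)` for swap-symmetric `Λ, η` (the Gram structure at a site mirror; the seam identity's
  positive part), and `oddTorus_not_structurallyRP`-type calibration is left to the toy job j006834.
-/

noncomputable section

open MeasureTheory Filter Topology
open scoped ComplexConjugate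
open Literature.Probability.LatticeModels
open Literature.MathematicalPhysics.QuantumLattice
open Literature.MathematicalPhysics.QuantumFieldTheory
open Literature.MathematicalPhysics.AQFT

namespace Summit.QuantumFields.YangMills.Cruxes.DiagonalMirrorRPR.Sketch

/-! ### The diagonal reflection on `ℤ⁴` -/

/-- Swap of the coordinates `0` and `1` of a site of `ℤ⁴`. -/
def swapSite (x : Site 4) : Site 4 := x ∘ Equiv.swap (0 : Fin 4) 1

/-- The induced map on positively oriented edges: the edge from `x` to `x + e₀` goes to the edge from
`θx` to `θx + e₁` — orientation is PRESERVED (no inverses, unlike the time reflection). -/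
def swapEdge (e : ZdEdge 4) : ZdEdge 4 := (swapSite e.1, Equiv.swap (0 : Fin 4) 1 e.2)

/-- The diagonal reflection `θ^* U = U ∘ swapEdge` on configurations. -/
def diagReflect {G : Type*} (U : LGConfig 4 G) : LGConfig 4 G := U ∘ swapEdge

/-- The light-cone coordinate `u = x₀ − x₁` (the mirror is `u = 0`). -/
def diagCoord (x : Site 4) : ℤ := x 0 - x 1

/-- Endpoint `x + eᵢ` of the edge `(x, i)`. -/
def edgeEnd (e : ZdEdge 4) : Site 4 := e.1 + Pi.single e.2 1

/-! ### The FILS 45° torus `T̃_N = ℤ⁴/Λ̃_N`, `Λ̃_N = ⟨N(e₀+e₁), N(e₀−e₁), Ne₂, Ne₃⟩` -/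

/-- Reduction of `ℤ⁴` modulo `Λ̃_N` into the fundamental box `[0,2N) × [0,N)³`
(`x₁ ↦ x₁ mod N` costs `m = x₁ div N` units of `N(e₀ ± e₁)`, which shifts `x₀` by `N m` mod `2N`). -/
def skewReduce (N : ℕ) (x : Site 4) : Site 4 :=
  ![(x 0 - (N : ℤ) * (x 1 / (N : ℤ))) % (2 * (N : ℤ)), x 1 % (N : ℤ), x 2 % (N : ℤ), x 3 % (N : ℤ)]

/-- `Λ̃_N`-periodisation of a configuration by its values on the edges based in the box. -/
def skewLift {G : Type*} (N : ℕ) (U : LGConfig 4 G) : LGConfig 4 G := fun e => U (skewReduce N e.1, e.2)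

/-- Sites of the fundamental box `[0,2N) × [0,N)³`. -/
def skewBoxSites (N : ℕ) : Finset (Site 4) :=
  (Finset.univ : Finset (Fin (2 * N) × Fin N × Fin N × Fin N)).image
    fun q => ![((q.1 : ℕ) : ℤ), ((q.2.1 : ℕ) : ℤ), ((q.2.2.1 : ℕ) : ℤ), ((q.2.2.2 : ℕ) : ℤ)]

/-- Edges based in the fundamental box (one per edge of `T̃_N`). -/
def skewBoxEdges (N : ℕ) : Finset (ZdEdge 4) := skewBoxSites N ×ˢ Finset.univ

variable {G : Type} [Group G] [TopologicalSpace G] [IsTopologicalGroup G] [CompactSpace G]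
  [MeasurableSpace G] [BorelSpace G] {Nc : ℕ}

/-- Wilson's action of ONE period of the `Λ̃_N`-periodic configuration: `∑_{p based in the box} Re tr ρ(U_p)`. -/
def skewAction (ρ : G →* Matrix (Fin Nc) (Fin Nc) ℂ) (N : ℕ) (U : LGConfig 4 G) : ℝ :=
  ∑ x ∈ skewBoxSites N, ∑ i : Fin 4, ∑ j : Fin 4, if i < j then plaquetteObs ρ x i j (skewLift N U) else 0

/-- Wilson's probability measure of the 45° torus `T̃_N` at inverse coupling `β` (tree normalisation
`exp(β ∑ₚ Re tr ρ(U_p))` as in `wilsonMeasure`), realised as a measure on `Λ̃_N`-periodic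
configurations of `ℤ⁴`: product Haar on the box edges, tilted, then periodised. -/
def skewWilsonMeasure (ρ : G →* Matrix (Fin Nc) (Fin Nc) ℂ) (β : ℝ) (N : ℕ) : Measure (LGConfig 4 G) :=
  ((((Measure.pi fun _ : ↥(skewBoxEdges N) => haarProbability G).map
      (glueWith (skewBoxEdges N) · (fun _ => (1 : G)))).tilted
      fun U => β * skewAction ρ N U).map (skewLift N))

/-- **First lemma of card `fortyfive-cover-descent` (B1).** For every compact group `G`, continuous
unitary matrix representation `ρ`, `β ≥ 0` and `N ≥ 1`, Wilson's measure on the 45° torus `T̃_N` is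
reflection positive for the swap `x₀ ↔ x₁`: for every bounded measurable `F` depending only on edges
whose endpoints have `u = x₀ − x₁ ∈ [0, N] (mod 2N)` (the closed half between the two site mirrors
`u = 0` and `u = N`), `∫ conj(F(θ^*U)) F(U) dμ ≥ 0`. (FILS cone argument: a `(0,1)`-plaquette cut by a
site mirror has its diagonal IN the mirror, `U_p = P₊ (θP₊)†`, and `exp((β) Re tr(g h†))` is a
Schur-positive kernel; `(0,μ), (1,μ), (μ,ν)`-plaquettes never straddle.) -/
def SkewTorusDiagonalRP : Prop :=
  ∀ (G : Type) [Group G] [TopologicalSpace G] [IsTopologicalGroup G] [CompactSpace G]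
    [MeasurableSpace G] [BorelSpace G] (Nc : ℕ) (ρ : G →* Matrix (Fin Nc) (Fin Nc) ℂ),
    Continuous ρ → (∀ g, ρ g ∈ Matrix.unitaryGroup (Fin Nc) ℂ) →
    ∀ (β : ℝ), 0 ≤ β → ∀ (N : ℕ), 1 ≤ N →
    ∀ (F : LGConfig 4 G → ℂ), Measurable F → (∃ C : ℝ, ∀ U, ‖F U‖ ≤ C) →
      DependsOn F {e : ZdEdge 4 | diagCoord e.1 % (2 * (N : ℤ)) ≤ N ∧ diagCoord (edgeEnd e) % (2 * (N : ℤ)) ≤ N} →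
      0 ≤ (∫ U, conj (F (diagReflect U)) * F U ∂(skewWilsonMeasure ρ β N)).re ∧
        (∫ U, conj (F (diagReflect U)) * F U ∂(skewWilsonMeasure ρ β N)).im = 0

/-- The curvature-string `n`-point function at step `k` computed on the 2:1 COVER `T̃_{N_k}`
(`N_k = sch.side k`), with the scheme's spacing, couplings and renormalisations — the analogue of
`latticeSchwinger` with `wilsonMeasure` on `ℤ⁴/N_kℤ⁴` replaced by `skewWilsonMeasure` on `T̃_{N_k}`. -/
def coverSchwinger (ρ : G →* Matrix (Fin Nc) (Fin Nc) ℂ) (sch : SpeciesScheme (YMSpecies G))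
    (O : YMSpecies G) (k n : ℕ) (f : Fin n → SchwartzMap (EuclideanSpace ℝ (Fin 4)) ℝ) : ℝ :=
  ∫ U, ∏ i, smearedLatticeField O.F (box 4 (sch.L k)) (sch.a k) (sch.c O k) (sch.m O k) (f i) U
    ∂(skewWilsonMeasure ρ (sch.β k) (sch.side k))

/-- **Second statement of card `fortyfive-cover-descent` (B2, the descent).** Passing to the double
cover does not change the scaling limit of the curvature strings: for compactly supported real test
functions the difference of the `n`-point functions on `ℤ⁴/N_kℤ⁴` and on `T̃_{N_k}` tends to `0`.
(Proposed proof: two exact transfer-matrix identities on fixed spatial slices — a thermal doubling in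
the `e₁`-period and a half-turn twist `U_{Ne₁}` at `e₀`-period `N` — for the POSITIVE self-adjoint
axis transfer matrices; sufficient: ground-state dominance `ζ_k → 0`, `η_P(N_k) → 0` on the two slices.) -/
def CoverInsensitivity (r : LatticeRep G) (sch : SpeciesScheme (YMSpecies G)) : Prop :=
  ∀ (n : ℕ), n ≠ 0 → ∀ (f : Fin n → SchwartzMap (EuclideanSpace ℝ (Fin 4)) ℝ),
    (∀ i, HasCompactSupport (f i)) →
      Tendsto (fun k : ℕ => latticeSchwinger r.ρ sch (fun s => s.F) k n (fun _ => r.curvature) f -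
        coverSchwinger r.ρ sch r.curvature k n f) atTop (𝓝 0)

/-! ### Site-mirror Gram structure with symmetric boundary data (card `seam-twist-identity`, positive part) -/

/-- **First lemma of card `seam-twist-identity` (A1).** Exact diagonal RP of the finite-volume Wilson
kernel `γ_Λ(·|η)` (`ymSpecification`) for every swap-symmetric finite edge set `Λ` and swap-symmetric
boundary condition `η`, `β ≥ 0`: the only mirror-crossing plaquettes are the `(0,1)`-plaquettes centred
on the site layer `u = 0`, whose Boltzmann factor is a Schur-positive kernel in `(P₊, θP₊)`. On the odd
torus this Gram structure is what survives at the good mirror; the seam carries the defect. -/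
def SymmetricBoxDiagonalRP : Prop :=
  ∀ (G : Type) [Group G] [TopologicalSpace G] [IsTopologicalGroup G] [CompactSpace G]
    [MeasurableSpace G] [BorelSpace G] (Nc : ℕ) (ρ : G →* Matrix (Fin Nc) (Fin Nc) ℂ),
    Continuous ρ → (∀ g, ρ g ∈ Matrix.unitaryGroup (Fin Nc) ℂ) →
    ∀ (β : ℝ), 0 ≤ β → ∀ (Λ : Finset (ZdEdge 4)), (∀ e, e ∈ Λ ↔ swapEdge e ∈ Λ) →
    ∀ (η : LGConfig 4 G), diagReflect η = η →
    ∀ (F : LGConfig 4 G → ℂ), Measurable F → (∃ C : ℝ, ∀ U, ‖F U‖ ≤ C) →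
      DependsOn F {e : ZdEdge 4 | 0 ≤ diagCoord e.1 ∧ 0 ≤ diagCoord (edgeEnd e)} →
      0 ≤ (∫ U, conj (F (diagReflect U)) * F U ∂(ymSpecification ρ β Λ η)).re ∧
        (∫ U, conj (F (diagReflect U)) * F U ∂(ymSpecification ρ β Λ η)).im = 0

end Summit.QuantumFields.YangMills.Cruxes.DiagonalMirrorRPR.Sketch

end
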